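import Mathlib
import Summits.ValiantsHypothesis.ValiantsHypothesis.Theorems.RigidityForcesSymmetryRankRigidMinimalReprLaplaceFiveThreeSlicesCoreInstances
import Summits.ValiantsHypothesis.ValiantsHypothesis.Theorems.RigidityForcesSymmetryRankRigidMinimalReprLaplaceContract
import Summits.ValiantsHypothesis.ValiantsHypothesis.Theorems.RigidityForcesSymmetryRankRigidMinimalReprLaplaceFiveAtMostTwoSlicesOf

/-!
# `LaplaceOptimalFive`, three slices: the exception hypotheses of `laplace_five_at_most_two_slices_of`, discharged
# (crux `RankRigidMinimalRepr`, stmt-ValiantsHypothesis-18034; frontier rung `LaplaceOptimalFive`, stmt-24813)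

val-width-24813-w1's `laplace_five_at_most_two_slices_of` (`…LaplaceFiveAtMostTwoSlicesOf.lean`) is conditional on three
hypotheses `hexA`, `hexB`, `hexC`: refutations of the 14 + 6 + 7 sorted labelled three-slices/three-pairs configurations
without an interleaved dual certificate (slot patterns `(0,0,0)`, `(0,0,1)`, `(0,1,2)`).  Here:

* `hexA_holds` — all 14 `(0,0,0)` exceptions are refuted in the kernel: six by support-core certificates
  (`core_C_*`, `…LaplaceFiveThreeSlicesCoreInstances.lean`), eight by the contraction count
  (`LaplaceContract.three_slices_contract`: three slices on one slot leave `4·3 = 12 < 24`);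
* `hexB_holds` — all 6 `(0,0,1)` exceptions: `3·{01}` by `core_B_01_01_01`, the five others by contraction at the
  doubled slot (`6 + 12 = 18 < 24`);
* `hexC_of_residual` — of the 7 `(0,1,2)` exceptions, the three triple cuts fall to `core_A_*`; the remaining FOUR
  (triangle `{01,02,12}`; `{01,02,34}`, `{01,12,34}`, `{02,12,34}`) are exactly the residual hypothesis of
  `laplace_five_at_most_two_slices_of_residual` (`…LaplaceFiveAtMostTwoSlices.lean`);
(so `laplace_five_at_most_two_slices_of hexA_holds hexB_holds (hexC_of_residual hres)` is a second route to
`laplace_five_at_most_two_slices_of_residual hres`, same statement — not restated here).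

No definitions.  HONEST FRAMING: exact partial results toward the frontier rung `LaplaceOptimalFive` (stmt-24813), which
stays OPEN (and so do the four residual configurations); nothing here bears on `VP ≠ VNP`, which is NOT proved.
-/

set_option autoImplicit false

-- the mandated summit-side namespace repeats a component by design (single-problem summit)
set_option linter.dupNamespace false

namespace Summit.ValiantsHypothesis.ValiantsHypothesis.Theorems.RigidityForcesSymmetryRankRigidMinimalRepr

namespace LaplaceFiveSlices

open Finset

/-- **`hexA` holds**: every exceptional configuration with the three slices on ONE slot is refuted in the kernel (six by support-core certificates, eight by the contraction count). -/
theorem hexA_holds :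
    ∀ p0 q0 p1 q1 p2 q2 : Fin 5, (p0, q0, p1, q1, p2, q2) ∈ ([
      (1, 2, 1, 2, 3, 4),
      (1, 2, 1, 3, 1, 4),
      (1, 2, 1, 3, 2, 3),
      (1, 2, 1, 4, 2, 4),
      (1, 2, 2, 3, 2, 4),
      (1, 2, 3, 4, 3, 4),
      (1, 3, 1, 3, 2, 4),
      (1, 3, 1, 4, 3, 4),
      (1, 3, 2, 3, 3, 4),
      (1, 3, 2, 4, 2, 4),
      (1, 4, 1, 4, 2, 3),
      (1, 4, 2, 3, 2, 3),
      (1, 4, 2, 4, 3, 4),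
      (2, 3, 2, 4, 3, 4)] :
      List (Fin 5 × Fin 5 × Fin 5 × Fin 5 × Fin 5 × Fin 5)) →
    ∀ (α : Fin 3 → Fin 5 → ℂ) (W : Fin 3 → (Fin 5 → Fin 5) → ℂ),
      (∀ k, ∀ v v' : Fin 5 → Fin 5, (∀ j, j ≠ (![0, 0, 0] : Fin 3 → Fin 5) k → v j = v' j) → W k v = W k v') →
      ∀ (u w : Fin 3 → (Fin 5 → Fin 5) → ℂ),
      (∀ t, ∀ v v' : Fin 5 → Fin 5,
          v ((![p0, p1, p2] : Fin 3 → Fin 5) t) = v' ((![p0, p1, p2] : Fin 3 → Fin 5) t) →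
          v ((![q0, q1, q2] : Fin 3 → Fin 5) t) = v' ((![q0, q1, q2] : Fin 3 → Fin 5) t) → u t v = u t v') →
      (∀ t, ∀ v v' : Fin 5 → Fin 5,
          (∀ j, j ≠ (![p0, p1, p2] : Fin 3 → Fin 5) t → j ≠ (![q0, q1, q2] : Fin 3 → Fin 5) t → v j = v' j) →
            w t v = w t v') →
      ¬ ∀ v : Fin 5 → Fin 5, (if Function.Injective v then (1 : ℂ) else 0) =
          (∑ k, α k (v ((![0, 0, 0] : Fin 3 → Fin 5) k)) * W k v) + ∑ t, u t v * w t v := by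
  intro p0 q0 p1 q1 p2 q2 hmem α W hW u w hu hw
  simp only [List.mem_cons, Prod.mk.injEq, List.not_mem_nil, or_false] at hmem
  rcases hmem with ⟨rfl, rfl, rfl, rfl, rfl, rfl⟩ |
    ⟨rfl, rfl, rfl, rfl, rfl, rfl⟩ |
    ⟨rfl, rfl, rfl, rfl, rfl, rfl⟩ |
    ⟨rfl, rfl, rfl, rfl, rfl, rfl⟩ |
    ⟨rfl, rfl, rfl, rfl, rfl, rfl⟩ |
    ⟨rfl, rfl, rfl, rfl, rfl, rfl⟩ |
    ⟨rfl, rfl, rfl, rfl, rfl, rfl⟩ |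
    ⟨rfl, rfl, rfl, rfl, rfl, rfl⟩ |
    ⟨rfl, rfl, rfl, rfl, rfl, rfl⟩ |
    ⟨rfl, rfl, rfl, rfl, rfl, rfl⟩ |
    ⟨rfl, rfl, rfl, rfl, rfl, rfl⟩ |
    ⟨rfl, rfl, rfl, rfl, rfl, rfl⟩ |
    ⟨rfl, rfl, rfl, rfl, rfl, rfl⟩ |
    ⟨rfl, rfl, rfl, rfl, rfl, rfl⟩
  · exact core_C_12_12_34 α W hW u w hu hw
  · exact LaplaceContract.three_slices_contract ![0, 0, 0] α W hW ![1, 1, 1] ![2, 3, 4] (by decide) u w hu hw 0 (by decide)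
      (by decide)
  · exact LaplaceContract.three_slices_contract ![0, 0, 0] α W hW ![1, 1, 2] ![2, 3, 3] (by decide) u w hu hw 0 (by decide)
      (by decide)
  · exact LaplaceContract.three_slices_contract ![0, 0, 0] α W hW ![1, 1, 2] ![2, 4, 4] (by decide) u w hu hw 0 (by decide)
      (by decide)
  · exact LaplaceContract.three_slices_contract ![0, 0, 0] α W hW ![1, 2, 2] ![2, 3, 4] (by decide) u w hu hw 0 (by decide)
      (by decide)
  · exact core_C_12_34_34 α W hW u w hu hw
  · exact core_C_13_13_24 α W hW u w hu hw
  · exact LaplaceContract.three_slices_contract ![0, 0, 0] α W hW ![1, 1, 3] ![3, 4, 4] (by decide) u w hu hw 0 (by decide)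
      (by decide)
  · exact LaplaceContract.three_slices_contract ![0, 0, 0] α W hW ![1, 2, 3] ![3, 3, 4] (by decide) u w hu hw 0 (by decide)
      (by decide)
  · exact core_C_13_24_24 α W hW u w hu hw
  · exact core_C_14_14_23 α W hW u w hu hw
  · exact core_C_14_23_23 α W hW u w hu hw
  · exact LaplaceContract.three_slices_contract ![0, 0, 0] α W hW ![1, 2, 3] ![4, 4, 4] (by decide) u w hu hw 0 (by decide)
      (by decide)
  · exact LaplaceContract.three_slices_contract ![0, 0, 0] α W hW ![2, 2, 3] ![3, 4, 4] (by decide) u w hu hw 0 (by decide)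
      (by decide)

/-- **`hexB` holds**: every exceptional `(x,x,y)` configuration is refuted in the kernel (`3·{{xy}}` by a support-core certificate, the five others by the contraction count). -/
theorem hexB_holds :
    ∀ p0 q0 p1 q1 p2 q2 : Fin 5, (p0, q0, p1, q1, p2, q2) ∈ ([
      (0, 1, 0, 1, 0, 1),
      (1, 2, 1, 3, 1, 4),
      (1, 2, 2, 3, 2, 4),
      (1, 3, 2, 3, 3, 4),
      (1, 4, 2, 4, 3, 4),
      (2, 3, 2, 4, 3, 4)] :
      List (Fin 5 × Fin 5 × Fin 5 × Fin 5 × Fin 5 × Fin 5)) →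
    ∀ (α : Fin 3 → Fin 5 → ℂ) (W : Fin 3 → (Fin 5 → Fin 5) → ℂ),
      (∀ k, ∀ v v' : Fin 5 → Fin 5, (∀ j, j ≠ (![0, 0, 1] : Fin 3 → Fin 5) k → v j = v' j) → W k v = W k v') →
      ∀ (u w : Fin 3 → (Fin 5 → Fin 5) → ℂ),
      (∀ t, ∀ v v' : Fin 5 → Fin 5,
          v ((![p0, p1, p2] : Fin 3 → Fin 5) t) = v' ((![p0, p1, p2] : Fin 3 → Fin 5) t) →
          v ((![q0, q1, q2] : Fin 3 → Fin 5) t) = v' ((![q0, q1, q2] : Fin 3 → Fin 5) t) → u t v = u t v') →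
      (∀ t, ∀ v v' : Fin 5 → Fin 5,
          (∀ j, j ≠ (![p0, p1, p2] : Fin 3 → Fin 5) t → j ≠ (![q0, q1, q2] : Fin 3 → Fin 5) t → v j = v' j) →
            w t v = w t v') →
      ¬ ∀ v : Fin 5 → Fin 5, (if Function.Injective v then (1 : ℂ) else 0) =
          (∑ k, α k (v ((![0, 0, 1] : Fin 3 → Fin 5) k)) * W k v) + ∑ t, u t v * w t v := by
  intro p0 q0 p1 q1 p2 q2 hmem α W hW u w hu hw
  simp only [List.mem_cons, Prod.mk.injEq, List.not_mem_nil, or_false] at hmem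
  rcases hmem with ⟨rfl, rfl, rfl, rfl, rfl, rfl⟩ |
    ⟨rfl, rfl, rfl, rfl, rfl, rfl⟩ |
    ⟨rfl, rfl, rfl, rfl, rfl, rfl⟩ |
    ⟨rfl, rfl, rfl, rfl, rfl, rfl⟩ |
    ⟨rfl, rfl, rfl, rfl, rfl, rfl⟩ |
    ⟨rfl, rfl, rfl, rfl, rfl, rfl⟩
  · exact core_B_01_01_01 α W hW u w hu hw
  · exact LaplaceContract.three_slices_contract ![0, 0, 1] α W hW ![1, 1, 1] ![2, 3, 4] (by decide) u w hu hw 0 (by decide)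
      (by decide)
  · exact LaplaceContract.three_slices_contract ![0, 0, 1] α W hW ![1, 2, 2] ![2, 3, 4] (by decide) u w hu hw 0 (by decide)
      (by decide)
  · exact LaplaceContract.three_slices_contract ![0, 0, 1] α W hW ![1, 2, 3] ![3, 3, 4] (by decide) u w hu hw 0 (by decide)
      (by decide)
  · exact LaplaceContract.three_slices_contract ![0, 0, 1] α W hW ![1, 2, 3] ![4, 4, 4] (by decide) u w hu hw 0 (by decide)
      (by decide)
  · exact LaplaceContract.three_slices_contract ![0, 0, 1] α W hW ![2, 2, 3] ![3, 4, 4] (by decide) u w hu hw 0 (by decide)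
      (by decide)

/-- **`hexC` modulo the four residual configurations**: of the seven exceptional `(x,y,z)` configurations, the three
triple cuts are refuted by support-core certificates; the triangle and the three «two inside + outside» labellings are
exactly the residual hypothesis `hres` of `laplace_five_at_most_two_slices_of_residual`. -/
theorem hexC_of_residual
    (hres : ∀ (c : Fin 3) (p0 q0 p1 q1 p2 q2 : Fin 5),
      (c, p0, q0, p1, q1, p2, q2) ∈ ([(0, 0, 1, 0, 2, 1, 2), (0, 0, 1, 0, 2, 3, 4), (0, 0, 1, 1, 2, 3, 4), (0, 0, 2, 1, 2, 3, 4)] : List (Fin 3 × Fin 5 × Fin 5 × Fin 5 × Fin 5 × Fin 5 × Fin 5)) →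
      ∀ (α : Fin 3 → Fin 5 → ℂ) (W : Fin 3 → (Fin 5 → Fin 5) → ℂ),
        (∀ k, ∀ v v' : Fin 5 → Fin 5, (∀ j, j ≠ (![![0, 1, 2], ![0, 0, 1], ![0, 0, 0]] : Fin 3 → Fin 3 → Fin 5) c k → v j = v' j) → W k v = W k v') →
        ∀ (u' w' : Fin 3 → (Fin 5 → Fin 5) → ℂ),
          (∀ t, ∀ v v' : Fin 5 → Fin 5, v ((![p0, p1, p2] : Fin 3 → Fin 5) t) = v' ((![p0, p1, p2] : Fin 3 → Fin 5) t) →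
            v ((![q0, q1, q2] : Fin 3 → Fin 5) t) = v' ((![q0, q1, q2] : Fin 3 → Fin 5) t) → u' t v = u' t v') →
          (∀ t, ∀ v v' : Fin 5 → Fin 5, (∀ j, j ≠ (![p0, p1, p2] : Fin 3 → Fin 5) t →
            j ≠ (![q0, q1, q2] : Fin 3 → Fin 5) t → v j = v' j) → w' t v = w' t v') →
          ¬ ∀ v : Fin 5 → Fin 5, (if Function.Injective v then (1 : ℂ) else 0) =
            (∑ k, α k (v ((![![0, 1, 2], ![0, 0, 1], ![0, 0, 0]] : Fin 3 → Fin 3 → Fin 5) c k)) * W k v) + ∑ t, u' t v * w' t v) :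
    ∀ p0 q0 p1 q1 p2 q2 : Fin 5, (p0, q0, p1, q1, p2, q2) ∈ ([
      (0, 1, 0, 1, 0, 1),
      (0, 1, 0, 2, 1, 2),
      (0, 1, 0, 2, 3, 4),
      (0, 1, 1, 2, 3, 4),
      (0, 2, 0, 2, 0, 2),
      (0, 2, 1, 2, 3, 4),
      (1, 2, 1, 2, 1, 2)] :
      List (Fin 5 × Fin 5 × Fin 5 × Fin 5 × Fin 5 × Fin 5)) →
    ∀ (α : Fin 3 → Fin 5 → ℂ) (W : Fin 3 → (Fin 5 → Fin 5) → ℂ),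
      (∀ k, ∀ v v' : Fin 5 → Fin 5, (∀ j, j ≠ (![0, 1, 2] : Fin 3 → Fin 5) k → v j = v' j) → W k v = W k v') →
      ∀ (u w : Fin 3 → (Fin 5 → Fin 5) → ℂ),
      (∀ t, ∀ v v' : Fin 5 → Fin 5,
          v ((![p0, p1, p2] : Fin 3 → Fin 5) t) = v' ((![p0, p1, p2] : Fin 3 → Fin 5) t) →
          v ((![q0, q1, q2] : Fin 3 → Fin 5) t) = v' ((![q0, q1, q2] : Fin 3 → Fin 5) t) → u t v = u t v') →
      (∀ t, ∀ v v' : Fin 5 → Fin 5,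
          (∀ j, j ≠ (![p0, p1, p2] : Fin 3 → Fin 5) t → j ≠ (![q0, q1, q2] : Fin 3 → Fin 5) t → v j = v' j) →
            w t v = w t v') →
      ¬ ∀ v : Fin 5 → Fin 5, (if Function.Injective v then (1 : ℂ) else 0) =
          (∑ k, α k (v ((![0, 1, 2] : Fin 3 → Fin 5) k)) * W k v) + ∑ t, u t v * w t v := by
  intro p0 q0 p1 q1 p2 q2 hmem α W hW u w hu hw
  simp only [List.mem_cons, Prod.mk.injEq, List.not_mem_nil, or_false] at hmem
  rcases hmem with ⟨rfl, rfl, rfl, rfl, rfl, rfl⟩ | ⟨rfl, rfl, rfl, rfl, rfl, rfl⟩ | ⟨rfl, rfl, rfl, rfl, rfl, rfl⟩ | ⟨rfl, rfl, rfl, rfl, rfl, rfl⟩ | ⟨rfl, rfl, rfl, rfl, rfl, rfl⟩ | ⟨rfl, rfl, rfl, rfl, rfl, rfl⟩ | ⟨rfl, rfl, rfl, rfl, rfl, rfl⟩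
  · exact core_A_01_01_01 α W hW u w hu hw
  · exact hres 0 0 1 0 2 1 2 (by decide) α W hW u w hu hw
  · exact hres 0 0 1 0 2 3 4 (by decide) α W hW u w hu hw
  · exact hres 0 0 1 1 2 3 4 (by decide) α W hW u w hu hw
  · exact core_A_02_02_02 α W hW u w hu hw
  · exact hres 0 0 2 1 2 3 4 (by decide) α W hW u w hu hw
  · exact core_A_12_12_12 α W hW u w hu hw

end LaplaceFiveSlices

end Summit.ValiantsHypothesis.ValiantsHypothesis.Theorems.RigidityForcesSymmetryRankRigidMinimalRepr
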